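import Summits.HodgeConjecture.HodgeConjecture.Theorems.UeP4OfEngines
import Summits.HodgeConjecture.HodgeConjecture.Theorems.UeP4N3core
import HarnessLib

/-!
# U-e P4 from (F) alone: the local holomorphic period map of the Siegel universal family

Sub-problem `HodgeConjecture` (cell HC_CM, (U)-lane node U-e P4; P4 lead B-p03 (g14)).  The P4 socket of the (U) head
(`UHead.Ue_P4_localHolomorphicPeriodMap`, text verbatim) from the single printed fact (F) `lan2013_siegelFineModuliScheme`
([Lan2013PELCompactifications] §1.4.1): ★/📝 `UeP4OfEngines.ue_P4_of_engines` composed with the now PROVED engine (N3-core) ★/📝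
`UnivFamilyN3core.ue_N3core_holds`.  [LangeBirkenhake1992] Ch. 8 §8.1 («the period map of a family of marked polarised abelian
varieties is holomorphic into `𝔥_g`»), [VoisinHodgeI2002] §10.2.1 Thm. 10.3, [MumfordFogartyKirwan1994] App. Ch. 7 §A.  Main result:
`ue_P4_of_F`.  HC_CM is proved only modulo the 7 printed citations until rung 0 closes; this helper changes no count.

## References
* [LangeBirkenhake1992] H. Lange, Ch. Birkenhake, *Complex Abelian Varieties*, Springer 1992, Ch. 8 §8.1–8.2 (Prop. 8.1.1).
* [VoisinHodgeI2002] C. Voisin, *Hodge Theory and Complex Algebraic Geometry I*, CUP 2002, §10.2.1 Thm. 10.3.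
* [MumfordFogartyKirwan1994] D. Mumford, J. Fogarty, F. Kirwan, *Geometric Invariant Theory*, 3rd ed., Appendix to Ch. 7 §A (p. 235).
* [Lan2013PELCompactifications] K.-W. Lan, *Arithmetic compactifications of PEL-type Shimura varieties*, §1.4.1.
-/

set_option autoImplicit false
set_option linter.dupNamespace false

noncomputable section

open CategoryTheory CategoryTheory.Limits AlgebraicGeometry Matrix Topology
open Literature.AlgebraicGeometry
open Literature.AlgebraicGeometry.Motives (SchemeOver ComplexPoints AlgPoints specOver AbelianVariety CartierDivisor fiberOver)
open Literature.AlgebraicGeometry.AbelianSchemes (PolarizedAbelianSchemeWithLevel AbelianSchemeOver)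
open Literature.AlgebraicGeometry.ModuliOfAbelianVarieties
open Literature.AlgebraicGeometry.ModuliOfAbelianVarieties.SiegelModuli
open Literature.NumberTheory.Automorphic (siegelUpperHalfSpace)
open Literature.NumberTheory.Adeles

namespace Summit.HodgeConjecture.HodgeConjecture.Theorems

namespace UeP4OfF

/-- **U-e P4 FROM (F) ALONE — `ue_P4_of_F (hF)`** (conclusion = the cell's P4 socket text verbatim).
[cite: LangeBirkenhake1992, Ch. 8 §8.1–8.2 (Prop. 8.1.1)] [cite: VoisinHodgeI2002, §10.2.1 Thm. 10.3]
[cite: MumfordFogartyKirwan1994, Appendix to Ch. 7 §A (p. 235)] -/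
theorem ue_P4_of_F (hF : lan2013_siegelFineModuliScheme) :
    ∀ (g N : ℕ) (δ : Fin g → ℕ) (_hg : 0 < g) (hδ : IsPolarizationType δ) (_hN : 3 ≤ N)
      (𝓜 : SiegelFineModuliScheme g N δ) (r : gspFinAdelic δ)
      (d : ℕ) [SmoothOfRelativeDimension d ((Motives.baseChange ℚ ℂ).obj 𝓜.M).hom],
      haveI : IsLocallyNoetherian (specOver ℚ ℂ).left :=
        inferInstanceAs (IsLocallyNoetherian (Spec (CommRingCat.of ℂ)))
      haveI : Smooth ((Motives.baseChange ℚ ℂ).obj 𝓜.M).hom := SmoothOfRelativeDimension.smooth d _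
      haveI : LocallyOfFiniteType ((Motives.baseChange ℚ ℂ).obj 𝓜.M).hom := inferInstance
      r ∈ principalLevelSubgroup δ 1 →
      ∀ (Z₀ : Matrix (Fin g) (Fin g) ℂ) (hZ₀ : Z₀ ∈ siegelUpperHalfSpace g)
        (P₀ : PolarizedAbelianSchemeWithLevel g N δ (specOver ℚ ℂ).left), IsAdmissibleAt hδ r Z₀ hZ₀ P₀ →
      ∃ (W : Set (ComplexPoints ((Motives.baseChange ℚ ℂ).obj 𝓜.M)))
        (π : ComplexPoints ((Motives.baseChange ℚ ℂ).obj 𝓜.M) → Matrix (Fin g) (Fin g) ℂ),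
        IsOpen W ∧
        AlgPoints.baseChangeEquiv (algebraMap ℚ ℂ) 𝓜.M (𝓜.classifyingMap (specOver ℚ ℂ) P₀) ∈ W ∧
        π (AlgPoints.baseChangeEquiv (algebraMap ℚ ℂ) 𝓜.M (𝓜.classifyingMap (specOver ℚ ℂ) P₀)) = Z₀ ∧
        ContinuousOn π W ∧
        -- `π` is holomorphic on `W`, entrywise, read in every holomorphic algebraic chart of `𝓜_ℂ(ℂ)`
        (∀ x ∈ W, ∀ (i j : Fin g),
          DifferentiableOn ℂ
            ((fun y ↦ π y i j) ∘ (ComplexPoints.algebraicChart ((Motives.baseChange ℚ ℂ).obj 𝓜.M) d x).symm)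
            ((ComplexPoints.algebraicChart ((Motives.baseChange ℚ ℂ).obj 𝓜.M) d x).target ∩
              (ComplexPoints.algebraicChart ((Motives.baseChange ℚ ℂ).obj 𝓜.M) d x).symm ⁻¹' W)) ∧
        -- `π` READS ADMISSIBILITY at `r` on `W`
        (∀ x ∈ W, ∃ hx : π x ∈ siegelUpperHalfSpace g,
          ∃ P' : PolarizedAbelianSchemeWithLevel g N δ (specOver ℚ ℂ).left,
            IsAdmissibleAt hδ r (π x) hx P' ∧
            AlgPoints.baseChangeEquiv (algebraMap ℚ ℂ) 𝓜.M (𝓜.classifyingMap (specOver ℚ ℂ) P') = x) :=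
  UeP4OfEngines.ue_P4_of_engines hF UnivFamilyN3core.ue_N3core_holds

end UeP4OfF

end Summit.HodgeConjecture.HodgeConjecture.Theorems

end
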